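import Literature.AlgebraicGeometry.HodgeTheory.AbelianVarietyIdealTorsionCountAlgClosed
import Literature.AlgebraicGeometry.AbelianSchemes.AbelianSchemeOverRingAction
import Literature.AlgebraicGeometry.AbelianSchemes.AbelianSchemeOverField
import Literature.AlgebraicGeometry.AbelianSchemes.AbelianSchemeOverFibreDim
import Literature.AlgebraicGeometry.AbelianSchemes.AbelianSchemeFixedPowBaseChange
import Literature.AlgebraicGeometry.AbelianSchemes.LevelStructureRefinement   -- ★ `dim_toAbelianVariety_of_isOfRelDim`
import Literature.FieldTheory.AlgClosed.PadicAlgClosureEmbedsComplex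
import HarnessLib

/-!
# The number of `𝔞`-torsion points of an abelian scheme with `𝒪`-action over an algebraically closed field `K ↪ ℂ`
# (in the `RingAction` ∕ `t ≫ ι(a) = 1` currency): `#{t ∈ A(K) | ι(𝔞)t = 1} = N𝔞 ^ (2g ∕ rk_ℤ 𝒪)` ([Shimura1998] §7.5 p. 72)

Topic `Literature/AlgebraicGeometry/AbelianSchemes`; namespace `Literature.AlgebraicGeometry.AbelianSchemes.AbelianSchemeOver` (grouping
sub-namespace `RingAction`).  THEOREMS ONLY (no definition, no named fact, no `instance`, no notation, no `sorry`).  Cell `hodgecm-mathlib`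
(D-0151), FLOOR 0, P6 «MOD programme» (crux hLiu418 = stmt-HodgeConjecture-24832, `--supports`, count-neutral): organ **(LAT-C) «THE JUNCTION»** of
the GENERIC-FIBRE road — the ORDER INPUT `#A_y[𝔞](Ω̄) = N𝔞^{2g∕[F:ℚ]}` UPSTAIRS, for EVERY nonzero ideal `𝔞` (not only `𝔞 = 𝔭 ∣ p`, where the dock
supplies it), in exactly the token shape of ★ (GF) `IdealTorsionGenericFibreEtale.natCard_idealTorsion_algPoints_baseChange_eq_finrank`
(`{t : AlgPoints (A.baseChange s).X K // ∀ a ∈ 𝔞, t ≫ (act.baseChange s).i a = 1}`), which then carries it DOWN to the special fibre for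
`𝔞 ⊔ (p) = ⊤` (H4 ORDER-INPUT census of line L3, item (2)).  Inputs: ★ (LAT-B) `AbelianVarietyIdealTorsionCountAlgClosed` (the count for
`Motives.AbelianVariety K`, `θ : 𝒪 →+* End A`, `K ↪ ℂ`), ★ `AbelianSchemeOverField` ∕ `AbelianSchemeOverBase` (`A.toAffine.toAbelianVariety`), ★
`AbelianSchemeOverFibreDim` (`dim A_s = g`), ★ `AbelianSchemeFixedPowBaseChange` (`act.baseChange`), ★ `PadicAlgClosureEmbedsComplex` (`F̄_w →+* ℂ`).
HC_CM is proved only modulo the printed citations (2 remaining named inputs hLiu418 24832, h413 24833) until rung 0 closes; generic, changes no count.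

THE MATHEMATICS ([Shimura1998] §7.1 (1) and §7.5 p. 72 L1–L3: for `(A, ι)` of type `(F)`, `2 dim A = m[F:ℚ]`, and `𝔞` prime to the characteristic,
"`𝔤(𝔞, A)` is of order `N(𝔞)^m`").  An `𝒪`-action `act` on an abelian scheme `A → Spec K` by group-scheme endomorphisms (★ `RingAction`: `ι(ab) =
ι(b) ≫ ι(a)`, `ι(a+b) = ι(a)·ι(b)`, `ι(1) = 𝟙`, `ι(0) = 1`) is the same thing as a ring homomorphism `θ : 𝒪 → End A` of the abelian variety
`A.toAffine.toAbelianVariety` with `θ(a) = ι(a)` on the underlying `K`-morphisms (§1; `End` multiplies by `f * g = g ≫ f`), and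
`t ≫ ι(a) = θ(a)(t)` on points; so ★ (LAT-B) gives the count with exponent `2 dim A ∕ rk_ℤ 𝒪`, and `dim A = g` for `A` of relative dimension `g`
(§2); §3 specialises to the base change `A ×_S Spec K` of an abelian scheme over any base at a geometric point `s : Spec K → S` (`dim = g`, ★
`dim_fibre_of_isOfRelDim`), in particular `K = F̄_w`.

## Contents
* §1–§2 (`A : AbelianSchemeOver (Spec K)`, `act : A.RingAction 𝒪`) `RingAction.exists_ringHom_end_toAbelianVariety`, `RingAction.finrank_int_dvd_two_mul_dim`,
  **`RingAction.natCard_idealTorsion_algPoints_eq_absNorm_pow`** (+ ★ `dim_toAbelianVariety_of_isOfRelDim` of `LevelStructureRefinement`),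
  **`RingAction.natCard_idealTorsion_algPoints_eq_absNorm_pow_of_isOfRelDim`**, `RingAction.finrank_int_dvd_two_mul_of_isOfRelDim`.
* §3 (`A : AbelianSchemeOver S`, `s : Spec K ⟶ S`) **`natCard_idealTorsion_algPoints_baseChange_eq_absNorm_pow`**,
  **`natCard_idealTorsion_algPoints_baseChange_eq_absNorm_pow_adicCompletion`** (`K = F̄_w`).

## References
* [Shimura1998] G. Shimura, *Abelian Varieties with Complex Multiplication and Modular Functions* (1998), §7.1 (1), §7.5 p. 72 L1–L3.
* [Kottwitz1992] R. Kottwitz, *Points on some Shimura varieties over finite fields*, JAMS 5 (1992), §5 p. 390 (`ι : 𝒪 → End(A)`).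
* [MumfordFogartyKirwan1994] D. Mumford, J. Fogarty, F. Kirwan, *Geometric Invariant Theory*, 3rd ed. (1994), Ch. 6 §1 Def. 6.1 (p. 115).
-/

set_option autoImplicit false

noncomputable section

open Module CategoryTheory Function AlgebraicGeometry
open scoped MonObj Cardinal

universe u

namespace Literature.AlgebraicGeometry.AbelianSchemes

namespace AbelianSchemeOver

namespace RingAction

open Literature.AlgebraicGeometry.Motives (SchemeOver specOver AlgPoints AbelianVariety)
open Literature.AlgebraicGeometry.HodgeTheory

variable {K : Type} [Field K] {A : AbelianSchemeOver (Spec (.of K))} {O : Type u} [CommRing O]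

/-- **An `𝒪`-action by group-scheme endomorphisms IS a ring homomorphism `θ : 𝒪 → End A` of the abelian variety `A.toAffine.toAbelianVariety`** with
`θ(a) = ι(a)` on the underlying `K`-morphisms (`End` multiplication is `f * g = g ≫ f`, matching `ι(ab) = ι(b) ≫ ι(a)`; addition of homomorphisms is
the pointwise product, matching `ι(a+b) = ι(a)·ι(b)`). [cite: Kottwitz1992, §5 (p. 390)] [cite: Shimura1998, §7.1 (1)] -/
theorem exists_ringHom_end_toAbelianVariety (act : A.RingAction O) :
    ∃ θ : O →+* End A.toAffine.toAbelianVariety, ∀ a, (θ a).hom.hom.hom = act.i a := by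
  haveI := act.isMonHom
  let e : O → End A.toAffine.toAbelianVariety := fun a =>
    InducedCategory.homMk (Grp.ofHom (A := A.X) (B := A.X) (act.i a))
  have he : ∀ a, (e a).hom.hom.hom = act.i a := fun a => rfl
  have hone : e 1 = 1 := by
    apply AbelianVariety.hom_ext
    rw [he, act.i_one]; rfl
  have hmul : ∀ a b, e (a * b) = e a * e b := by
    intro a b
    apply AbelianVariety.hom_ext
    rw [he, act.i_mul]
    change act.i b ≫ act.i a = (e b ≫ e a).hom.hom.hom
    rfl
  have hzero : e 0 = 0 := by
    apply AbelianVariety.hom_ext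
    rw [he, act.i_zero]; rfl
  have hadd : ∀ a b, e (a + b) = e a + e b := by
    intro a b
    apply AbelianVariety.hom_ext
    rw [he, act.i_add]; rfl
  exact ⟨{ toFun := e, map_one' := hone, map_mul' := hmul, map_zero' := hzero, map_add' := hadd }, he⟩

variable [IsDedekindDomain O] [Module.Free ℤ O] [Module.Finite ℤ O]

/-- **`rk_ℤ 𝒪 ∣ 2 dim A`** for an abelian scheme over a field `K` admitting `K →+* ℂ`, with an `𝒪`-action (`𝒪` Dedekind, finite free over `ℤ`).
[cite: Shimura1998, §7.1 (1)] -/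
theorem finrank_int_dvd_two_mul_dim (act : A.RingAction O) (σ : K →+* ℂ) : finrank ℤ O ∣ 2 * A.toAffine.toAbelianVariety.dim := by
  obtain ⟨θ, -⟩ := exists_ringHom_end_toAbelianVariety act
  exact AbelianVariety.finrank_int_dvd_two_mul_dim_of_ringHom_complex σ θ

/-- **THE COUNT in `RingAction` currency: `#{t ∈ A(K) | t ≫ ι(a) = 1 ∀ a ∈ 𝔞} = N𝔞 ^ (2 dim A ∕ rk_ℤ 𝒪)`** for an abelian scheme `A` over an
ALGEBRAICALLY CLOSED field `K` admitting `K →+* ℂ`, an `𝒪`-action `act` (`𝒪` Dedekind, finite free over `ℤ`) and `𝔞 ≠ 0` (★ (LAT-B)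
`natCard_idealTorsion_eq_absNorm_pow_of_ringHom_complex` through §1; `IsMonHom.monoidHom_apply`). [cite: Shimura1998, §7.5 p. 72 ("`𝔤(𝔞, A)` is of order `N(𝔞)^m`")] -/
theorem natCard_idealTorsion_algPoints_eq_absNorm_pow [IsAlgClosed K] (act : A.RingAction O) (σ : K →+* ℂ) (𝔞 : Ideal O)
    (h𝔞 : 𝔞 ≠ ⊥) :
    Nat.card {t : AlgPoints A.X K // ∀ a ∈ 𝔞, t ≫ act.i a = 1} =
      Ideal.absNorm 𝔞 ^ (2 * A.toAffine.toAbelianVariety.dim / finrank ℤ O) := by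
  obtain ⟨θ, hθ⟩ := exists_ringHom_end_toAbelianVariety act
  rw [← AbelianVariety.natCard_idealTorsion_eq_absNorm_pow_of_ringHom_complex σ θ 𝔞 h𝔞]
  refine Nat.card_congr (Equiv.subtypeEquivRight fun t => ?_)
  refine forall₂_congr fun a _ => ?_
  rw [IsMonHom.monoidHom_apply, hθ]
  rfl

/-- **THE COUNT for an abelian scheme of relative dimension `g` over an algebraically closed field `K ↪ ℂ`:
`#{t ∈ A(K) | t ≫ ι(a) = 1 ∀ a ∈ 𝔞} = N𝔞 ^ (2g ∕ rk_ℤ 𝒪)`.** [cite: Shimura1998, §7.5 p. 72 ("`𝔤(𝔞, A)` is of order `N(𝔞)^m`")] -/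
theorem natCard_idealTorsion_algPoints_eq_absNorm_pow_of_isOfRelDim [IsAlgClosed K] (act : A.RingAction O) (σ : K →+* ℂ)
    {g : ℕ} (hA : A.IsOfRelDim g) (𝔞 : Ideal O) (h𝔞 : 𝔞 ≠ ⊥) :
    Nat.card {t : AlgPoints A.X K // ∀ a ∈ 𝔞, t ≫ act.i a = 1} = Ideal.absNorm 𝔞 ^ (2 * g / finrank ℤ O) := by
  rw [natCard_idealTorsion_algPoints_eq_absNorm_pow act σ 𝔞 h𝔞, dim_toAbelianVariety_of_isOfRelDim hA]

/-- `rk_ℤ 𝒪 ∣ 2g` for an abelian scheme of relative dimension `g` over a field `K` with `K →+* ℂ` carrying an `𝒪`-action. [cite: Shimura1998, §7.1 (1)] -/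
theorem finrank_int_dvd_two_mul_of_isOfRelDim (act : A.RingAction O) (σ : K →+* ℂ) {g : ℕ} (hA : A.IsOfRelDim g) :
    finrank ℤ O ∣ 2 * g := by
  rw [← dim_toAbelianVariety_of_isOfRelDim hA]
  exact finrank_int_dvd_two_mul_dim act σ

end RingAction

/-! ## §3 Fibre form: a geometric point `s : Spec K → S` of an abelian scheme `A → S` with `𝒪`-action -/

section Fibre

open Literature.AlgebraicGeometry.Motives (SchemeOver specOver AlgPoints AbelianVariety)

variable {S : Scheme.{0}} {A : AbelianSchemeOver S} {O : Type u} [CommRing O] [IsDedekindDomain O] [Module.Free ℤ O]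
  [Module.Finite ℤ O]

/-- **FIBRE FORM: `#{t ∈ A_s(K) | 𝔞 t = 1} = N𝔞 ^ (2g ∕ rk_ℤ 𝒪)`** for an abelian scheme `A → S` of relative dimension `g` with an `𝒪`-action
`act`, a geometric point `s : Spec K → S` with `K` algebraically closed admitting `K →+* ℂ` (e.g. `K = F̄_w`), and a nonzero ideal `𝔞` — the
`t ≫ (act.baseChange s).i a = 1` count of the base change `A ×_S Spec K` (the shape of ★ (GF) `natCard_idealTorsion_algPoints_baseChange_eq_finrank`).
[cite: Shimura1998, §7.5 p. 72 ("`𝔤(𝔞, A)` is of order `N(𝔞)^m`")] -/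
theorem natCard_idealTorsion_algPoints_baseChange_eq_absNorm_pow {K : Type} [Field K] [IsAlgClosed K] (σ : K →+* ℂ)
    (act : A.RingAction O) {g : ℕ} (hA : A.IsOfRelDim g) (s : Spec (.of K) ⟶ S) (𝔞 : Ideal O) (h𝔞 : 𝔞 ≠ ⊥) :
    Nat.card {t : AlgPoints (A.baseChange s).X K // ∀ a ∈ 𝔞, t ≫ (act.baseChange s).i a = 1} =
      Ideal.absNorm 𝔞 ^ (2 * g / finrank ℤ O) := by
  rw [RingAction.natCard_idealTorsion_algPoints_eq_absNorm_pow (act.baseChange s) σ 𝔞 h𝔞]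
  change Ideal.absNorm 𝔞 ^ (2 * (A.fibre s).toAbelianVariety.dim / finrank ℤ O) = _
  rw [dim_fibre_of_isOfRelDim hA s]

/-- **The `F̄_w` instance** (`F` a number field, `w` a finite place; ★ `nonempty_ringHom_algebraicClosure_adicCompletion_complex`): the
geometric generic fibre of the `P6` moduli datum. [cite: Shimura1998, §7.5 p. 72 ("`𝔤(𝔞, A)` is of order `N(𝔞)^m`")] -/
theorem natCard_idealTorsion_algPoints_baseChange_eq_absNorm_pow_adicCompletion (F : Type) [Field F] [NumberField F]
    (w : IsDedekindDomain.HeightOneSpectrum (NumberField.RingOfIntegers F)) (act : A.RingAction O) {g : ℕ} (hA : A.IsOfRelDim g)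
    (s : Spec (.of (AlgebraicClosure (w.adicCompletion F))) ⟶ S) (𝔞 : Ideal O) (h𝔞 : 𝔞 ≠ ⊥) :
    Nat.card {t : AlgPoints (A.baseChange s).X (AlgebraicClosure (w.adicCompletion F)) //
        ∀ a ∈ 𝔞, t ≫ (act.baseChange s).i a = 1} = Ideal.absNorm 𝔞 ^ (2 * g / finrank ℤ O) := by
  obtain ⟨τ⟩ := Literature.FieldTheory.AlgClosed.nonempty_ringHom_algebraicClosure_adicCompletion_complex F w
  exact natCard_idealTorsion_algPoints_baseChange_eq_absNorm_pow τ act hA s 𝔞 h𝔞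

end Fibre

end AbelianSchemeOver

end Literature.AlgebraicGeometry.AbelianSchemes

end
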